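import Summits.HodgeConjecture.HodgeConjecture.Theorems.NikulinTwinTransportLefschetzOneOneK3ZigzagLocal
import Literature.Geometry.Kaehler.DolbeaultChartAcyclic
import Literature.NumberTheory.Transcendental.DeRhamTheoremCechProofs

/-!
# Route NikulinTwinTransport — `LefschetzOneOneK3`, `∂∂̄`–exponential line: the zigzag data on chart-convex sets

Existence of the local data of the Čech–`∂̄` construction of a holomorphic line bundle from a
closed real `(1,1)`-form `ω` (helper file for the route item `LefschetzOneOneK3`), on the chart
sets `U = chartSet 𝓘(ℝ, E) p C` of open convex `C` — the members and finite intersections of the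
tree's chart-convex covers (`Literature.NumberTheory.Transcendental.ChartConvexCover`):

* `exists_real_primitive_one` — a real smooth `1`-form `α` on `U` with `dα = ω` on `U`
  (Poincaré lemma on chart-convex sets, `localClosedForms_chartSet_le_localExactForms`, and real
  parts);
* `exists_dolbeaultBar_primitive` — a complex function `φ`, real-`C^∞` on `U`, with
  `∂̄φ = α^{0,1}` on `U` (the `∂̄`-Poincaré lemma on chart sets, `isDolbeaultAcyclic_chartSet`;
  `α^{0,1}` is `∂̄`-closed because `dα = ω` has type `(1,1)`);
* `exists_real_primitive_zero` — a real function `f`, `C^∞` on `U`, with `df = γ` on `U` for a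
  real closed `1`-form `γ` on `U` (Poincaré lemma in degree one);
* `exists_const_of_mextDeriv_eq_zero` — a real function with `d(f) = 0` on `U` is constant on
  `U` (chart sets of convex sets are connected).
-/

noncomputable section

open scoped Manifold ContDiff Topology ComplexConjugate
open Set Filter
open Literature.Geometry.Kaehler
open Literature.NumberTheory.Transcendental

namespace Summit.HodgeConjecture.HodgeConjecture.Theorems

section Zigzag

variable {E : Type} [NormedAddCommGroup E] [NormedSpace ℂ E]
  {M : Type} [TopologicalSpace M] [ChartedSpace E M]

/-! ### Real parts of forms -/

/-- Conjugation of forms commutes with real scalars. [folklore] -/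
theorem conj_real_smul {k : ℕ} (r : ℝ) (β : MForm 𝓘(ℝ, E) M ℂ k) : (r • β).conj = r • β.conj := by
  funext x; ext v; simp

/-- The real part `½(β + β̄)` of a form is real. [folklore] -/
theorem conj_half_add_conj {k : ℕ} (β : MForm 𝓘(ℝ, E) M ℂ k) :
    ((1 / 2 : ℝ) • (β + β.conj)).conj = (1 / 2 : ℝ) • (β + β.conj) := by
  rw [conj_real_smul, MForm.conj_add, MForm.conj_conj, add_comm]

/-- A `0`-form evaluated at the (unique) empty tuple: the function it comes from. [folklore] -/
theorem ofFun_eval_default (β : MForm 𝓘(ℝ, E) M ℂ 0) :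
    (MForm.ofFun 𝓘(ℝ, E) fun y ↦ β y default) = β := by
  funext y; ext v; rw [MForm.ofFun_apply, Subsingleton.elim v default]

/-- The real part of a `0`-form, as the `0`-form of a real function. [folklore] -/
theorem ofFun_re_eval_default (β : MForm 𝓘(ℝ, E) M ℂ 0) :
    (MForm.ofFun 𝓘(ℝ, E) fun y ↦ (((β y default).re : ℝ) : ℂ)) = (1 / 2 : ℝ) • (β + β.conj) := by
  funext y; ext v
  rw [MForm.ofFun_apply, Subsingleton.elim default v, Complex.re_eq_add_conj]
  simp only [Pi.smul_apply, Pi.add_apply, ContinuousAlternatingMap.smul_apply,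
    ContinuousAlternatingMap.add_apply, MForm.conj_apply, Complex.real_smul]
  push_cast
  ring

/-- **`d` of the real part at a smooth point**: if `β` is smooth at `x` with `dβ = γ` at `x`
for a real form `γ`, then `d(½(β + β̄)) = γ` at `x` (`dβ̄ = \overline{dβ}`). [folklore] -/
theorem mextDeriv_half_add_conj_apply {k : ℕ} {β : MForm 𝓘(ℝ, E) M ℂ k} {γ : MForm 𝓘(ℝ, E) M ℂ (k + 1)}
    {x : M} (hβ : β.SmoothAt x) (hd : mextDeriv β x = γ x) (hγ : γ.conj = γ) :
    mextDeriv ((1 / 2 : ℝ) • (β + β.conj)) x = γ x := by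
  rw [mextDeriv_smul, Pi.smul_apply, mextDeriv_add_apply hβ (smoothAt_conj hβ), mextDeriv_conj_holds,
    hd]
  have h2 : (mextDeriv β).conj x = γ x := by
    conv_rhs => rw [← hγ]
    change (Complex.conjCLE : ℂ →L[ℝ] ℂ).compContinuousAlternatingMap (mextDeriv β x) =
      (Complex.conjCLE : ℂ →L[ℝ] ℂ).compContinuousAlternatingMap (γ x)
    rw [hd]
  rw [h2, ← two_smul ℝ (γ x), smul_smul]
  norm_num

/-! ### Poincaré: a real primitive of a closed real `2`-form on a chart-convex set -/

variable [IsManifold 𝓘(ℝ, E) ∞ M] [FiniteDimensional ℂ E]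

/-- **A real smooth primitive `α` of `ω` on a chart-convex set** `U = chartSet p C` (`C` open
convex in the chart target): for `ω` smooth and closed at the points of `U` and real, there is a
real `1`-form `α` on `U` (smooth on `U`, zero off `U`) with `dα = ω` on `U`. (Poincaré lemma on
chart-convex sets, then `α ↦ ½(α + ᾱ)`.) [cite: LeeSmoothManifolds2013, Thm. 17.14] -/
theorem exists_real_primitive_one (p : M) {C : Set E} (hC : IsOpen C) (hCc : Convex ℝ C)
    (hCT : C ⊆ (extChartAt 𝓘(ℝ, E) p).target) {ω' : MForm 𝓘(ℝ, E) M ℂ 2}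
    (hωs : ∀ x ∈ chartSet 𝓘(ℝ, E) p C, ω'.SmoothAt x)
    (hωc : ∀ x ∈ chartSet 𝓘(ℝ, E) p C, mextDeriv ω' x = 0) (hωr : ω'.conj = ω') :
    ∃ α : MForm 𝓘(ℝ, E) M ℂ 1, α ∈ smoothFormsOn 𝓘(ℝ, E) ℂ (chartSet 𝓘(ℝ, E) p C) 1 ∧
      α.conj = α ∧ ∀ x ∈ chartSet 𝓘(ℝ, E) p C, mextDeriv α x = ω' x := by
  haveI : FiniteDimensional ℝ E := FiniteDimensional.complexToReal E
  set U := chartSet 𝓘(ℝ, E) p C with hU_def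
  have hU : IsOpen U := isOpen_chartSet 𝓘(ℝ, E) p hC
  -- `ω|_U` is a closed form on `U`, hence exact
  have hωU : ω'.restr U ∈ localClosedForms 𝓘(ℝ, E) ℂ 2 U := by
    refine ⟨⟨fun x hx ↦ (MForm.smoothAt_restr_iff hU _ hx).2 (hωs x hx),
      fun x hx ↦ MForm.restr_apply_of_notMem _ hx⟩, fun x hx ↦ ?_⟩
    rw [mextDeriv_restr_apply hU _ hx, hωc x hx]
  obtain ⟨β, hβ⟩ := (mem_localExactForms_succ_iff hU).1
    (localClosedForms_chartSet_le_localExactForms (I := 𝓘(ℝ, E)) (F := ℂ) (k := 1) p hC hCc hCT hωU)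
  have hdβ : ∀ x ∈ U, mextDeriv (β : MForm 𝓘(ℝ, E) M ℂ 1) x = ω' x := fun x hx ↦ by
    rw [← localD_apply_of_mem hU β hx, hβ, MForm.restr_apply_of_mem _ hx]
  refine ⟨(1 / 2 : ℝ) • ((β : MForm 𝓘(ℝ, E) M ℂ 1) + (β : MForm 𝓘(ℝ, E) M ℂ 1).conj), ?_,
    conj_half_add_conj _, fun x hx ↦ mextDeriv_half_add_conj_apply (β.2.1 x hx) (hdβ x hx) hωr⟩
  refine Submodule.smul_mem _ _ (Submodule.add_mem _ β.2 ⟨fun x hx ↦ smoothAt_conj (β.2.1 x hx),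
    fun x hx ↦ ?_⟩)
  change (Complex.conjCLE : ℂ →L[ℝ] ℂ).compContinuousAlternatingMap ((β : MForm 𝓘(ℝ, E) M ℂ 1) x) = 0
  rw [β.2.2 x hx]
  ext v; simp

/-! ### Poincaré in degree one: a real function primitive of a closed real `1`-form -/

/-- **A real `C^∞` primitive `f` of a closed real `1`-form `γ` on a chart-convex set**:
`df = γ` on `U = chartSet p C` (Poincaré lemma in degree `1`, then the real part).
[cite: LeeSmoothManifolds2013, Thm. 17.14] -/
theorem exists_real_primitive_zero (p : M) {C : Set E} (hC : IsOpen C) (hCc : Convex ℝ C)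
    (hCT : C ⊆ (extChartAt 𝓘(ℝ, E) p).target) {γ : MForm 𝓘(ℝ, E) M ℂ 1}
    (hγs : ∀ x ∈ chartSet 𝓘(ℝ, E) p C, γ.SmoothAt x)
    (hγc : ∀ x ∈ chartSet 𝓘(ℝ, E) p C, mextDeriv γ x = 0) (hγr : γ.conj = γ) :
    ∃ f : M → ℝ, (∀ x ∈ chartSet 𝓘(ℝ, E) p C, (MForm.ofFun 𝓘(ℝ, E) fun y ↦ ((f y : ℝ) : ℂ)).SmoothAt x) ∧
      ∀ x ∈ chartSet 𝓘(ℝ, E) p C, mextDeriv (MForm.ofFun 𝓘(ℝ, E) fun y ↦ ((f y : ℝ) : ℂ)) x = γ x := by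
  haveI : FiniteDimensional ℝ E := FiniteDimensional.complexToReal E
  set U := chartSet 𝓘(ℝ, E) p C with hU_def
  have hU : IsOpen U := isOpen_chartSet 𝓘(ℝ, E) p hC
  have hγU : γ.restr U ∈ localClosedForms 𝓘(ℝ, E) ℂ 1 U := by
    refine ⟨⟨fun x hx ↦ (MForm.smoothAt_restr_iff hU _ hx).2 (hγs x hx),
      fun x hx ↦ MForm.restr_apply_of_notMem _ hx⟩, fun x hx ↦ ?_⟩
    rw [mextDeriv_restr_apply hU _ hx, hγc x hx]
  obtain ⟨β, hβ⟩ := (mem_localExactForms_succ_iff hU).1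
    (localClosedForms_chartSet_le_localExactForms (I := 𝓘(ℝ, E)) (F := ℂ) (k := 0) p hC hCc hCT hγU)
  have hdβ : ∀ x ∈ U, mextDeriv (β : MForm 𝓘(ℝ, E) M ℂ 0) x = γ x := fun x hx ↦ by
    rw [← localD_apply_of_mem hU β hx, hβ, MForm.restr_apply_of_mem _ hx]
  refine ⟨fun y ↦ ((β : MForm 𝓘(ℝ, E) M ℂ 0) y default).re, fun x hx ↦ ?_, fun x hx ↦ ?_⟩
  · rw [ofFun_re_eval_default]
    exact ((β.2.1 x hx).add (smoothAt_conj (β.2.1 x hx))).smul _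
  · rw [ofFun_re_eval_default]
    exact mextDeriv_half_add_conj_apply (β.2.1 x hx) (hdβ x hx) hγr

/-! ### Constancy of a function with vanishing differential on a chart-convex set -/

omit [FiniteDimensional ℂ E] in
/-- **A real function with `df = 0` on a chart-convex set is constant there** (read in the chart,
a function with vanishing derivative on a convex open set is constant).
[cite: LeeSmoothManifolds2013, Prop. 17.6] -/
theorem exists_const_of_mextDeriv_eq_zero (p : M) {C : Set E} (hC : IsOpen C) (hCc : Convex ℝ C)
    (hCT : C ⊆ (extChartAt 𝓘(ℝ, E) p).target) {g : M → ℝ}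
    (hgs : ∀ x ∈ chartSet 𝓘(ℝ, E) p C, (MForm.ofFun 𝓘(ℝ, E) fun y ↦ ((g y : ℝ) : ℂ)).SmoothAt x)
    (hdg : ∀ x ∈ chartSet 𝓘(ℝ, E) p C, mextDeriv (MForm.ofFun 𝓘(ℝ, E) fun y ↦ ((g y : ℝ) : ℂ)) x = 0) :
    ∃ c : ℝ, ∀ x ∈ chartSet 𝓘(ℝ, E) p C, g x = c := by
  set U := chartSet 𝓘(ℝ, E) p C with hU_def
  have hU : IsOpen U := isOpen_chartSet 𝓘(ℝ, E) p hC
  rcases U.eq_empty_or_nonempty with he | ⟨x₀, hx₀⟩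
  · exact ⟨0, fun x hx ↦ absurd hx (by rw [he]; exact notMem_empty x)⟩
  refine ⟨g x₀, fun x hx ↦ ?_⟩
  set α : MForm 𝓘(ℝ, E) M ℂ 0 := (MForm.ofFun 𝓘(ℝ, E) fun y ↦ ((g y : ℝ) : ℂ)).restr U with hα_def
  have hα : α ∈ localClosedForms 𝓘(ℝ, E) ℂ 0 U := by
    refine ⟨⟨fun x hx ↦ (MForm.smoothAt_restr_iff hU _ hx).2 (hgs x hx),
      fun x hx ↦ MForm.restr_apply_of_notMem _ hx⟩, fun x hx ↦ ?_⟩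
    rw [mextDeriv_restr_apply hU _ hx, hdg x hx]
  -- compare the chart representatives at `e x` and `e x₀`
  have key := inChart_apply_eq_of_mem_localClosedForms_zero (I := 𝓘(ℝ, E)) p hC hCc hCT hα hx₀.2 hx.2
  have hev : ∀ {z : M}, z ∈ U → α.inChart p (extChartAt 𝓘(ℝ, E) p z) default = (g z : ℂ) := by
    intro z hz
    rw [MForm.inChart_apply, (extChartAt 𝓘(ℝ, E) p).left_inv hz.1, hα_def,
      MForm.restr_apply_of_mem _ hz, MForm.ofFun_apply]
  have h := congrArg (fun (φ : E [⋀^Fin 0]→L[ℝ] ℂ) ↦ φ default) key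
  simp only [hev hx, hev hx₀] at h
  exact_mod_cast h

/-! ### `∂̄`-Poincaré: a `∂̄`-primitive of `α^{0,1}` on a chart-convex set -/

variable [T2Space M] [IsManifold 𝓘(ℂ, E) ω M]

/-- **A `∂̄`-primitive `φ` of `α^{0,1}` on a chart-convex set.** For a `1`-form `α` on
`U = chartSet p C` with `dα = ω` on `U` for a form `ω` of type `(1,1)`, the `(0,1)`-part `α^{0,1}`
is `∂̄`-closed on `U` (`d = ∂ + ∂̄`), hence — chart sets of convex opens being `∂̄`-acyclic
(`isDolbeaultAcyclic_chartSet`, the `∂̄`-Poincaré lemma) — `α^{0,1} = ∂̄φ` on `U` for a complex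
function `φ` real-`C^∞` on `U`. [cite: VoisinHodgeI2002, Prop. 2.36] [cite: GriffithsHarris1978, p. 25] -/
theorem exists_dolbeaultBar_primitive (p : M) {C : Set E} (hC : IsOpen C) (hCc : Convex ℝ C)
    (hCt : C ⊆ (chartAt E p).target) {α : MForm 𝓘(ℝ, E) M ℂ 1}
    (hα : α ∈ smoothFormsOn 𝓘(ℝ, E) ℂ (chartSet 𝓘(ℝ, E) p C) 1) {ω' : MForm 𝓘(ℝ, E) M ℂ 2}
    (hω : IsOfType 1 1 ω') (hdα : ∀ x ∈ chartSet 𝓘(ℝ, E) p C, mextDeriv α x = ω' x) :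
    ∃ φ : M → ℂ, (∀ x ∈ chartSet 𝓘(ℝ, E) p C, (MForm.ofFun 𝓘(ℝ, E) φ).SmoothAt x) ∧
      ∀ x ∈ chartSet 𝓘(ℝ, E) p C,
        α.typeComponent 0 1 x = dolbeaultBar (MForm.ofFun 𝓘(ℝ, E) φ) x := by
  set U := chartSet 𝓘(ℝ, E) p C with hU_def
  have hU : IsOpen U := isOpen_chartSet 𝓘(ℝ, E) p hC
  -- `γ = α^{0,1}|_U ∈ A^{0,1}(U)` is `∂̄_U`-closed
  set γ : MForm 𝓘(ℝ, E) M ℂ 1 := (α.typeComponent 0 1).restr U with hγ_def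
  have hαev : ∀ x ∈ U, ∀ᶠ z in 𝓝 x, α.SmoothAt z := fun x hx ↦ eventually_smoothAt_of_mem hU hα hx
  have hγ : γ ∈ pqFormsOn E M U 0 1 :=
    ⟨fun x hx ↦ (MForm.smoothAt_restr_iff hU _ hx).2 (smoothAt_typeComponent 0 1 (hαev x hx)),
      fun x hx ↦ MForm.restr_apply_of_notMem _ hx,
      (isOfType_typeComponent_holds (p := 0) (q := 1) rfl α).restr U⟩
  have hγc : localDbar E M hU 0 1 ⟨γ, hγ⟩ = 0 := by
    apply Subtype.ext
    rw [coe_localDbar]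
    funext x
    by_cases hx : x ∈ U
    · rw [MForm.restr_apply_of_mem _ hx]
      change dolbeaultBar γ x = 0
      rw [dolbeaultBar_congr_of_eventuallyEq (MForm.restr_eventuallyEq hU (α.typeComponent 0 1) hx)]
      refine dolbeaultBar_typeComponent_zero_one_apply_eq_zero (hαev x hx) ?_
      rw [typeComponent_apply_congr 0 2 (hdα x hx)]
      exact congrFun (IsOfType.typeComponent_of_ne_holds hω (Or.inl (by norm_num))) x
    · rw [MForm.restr_apply_of_notMem _ hx]
      rfl
  -- `∂̄`-Poincaré on the chart set
  obtain ⟨β, hβ⟩ := isDolbeaultAcyclic_chartSet p hC hCc hCt 0 0 ⟨γ, hγ⟩ hγc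
  refine ⟨fun y ↦ (β : MForm 𝓘(ℝ, E) M ℂ 0) y default, fun x hx ↦ ?_, fun x hx ↦ ?_⟩
  · rw [ofFun_eval_default]
    exact β.2.1 x hx
  · rw [ofFun_eval_default]
    have h := congrArg (fun (δ : pqFormsOn E M U 0 1) ↦ (δ : MForm 𝓘(ℝ, E) M ℂ 1) x) hβ
    simp only [coe_localDbar] at h
    rw [MForm.restr_apply_of_mem _ hx] at h
    rw [h]
    change _ = ((α.typeComponent 0 1).restr U) x
    rw [MForm.restr_apply_of_mem _ hx]

end Zigzag

end Summit.HodgeConjecture.HodgeConjecture.Theorems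

end
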